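import Literature.NumberTheory.Automorphic.UnitaryGroupBorelHeightBigCell
import HarnessLib

/-!
# Godement's pairing inequality for the hermitian form of `U(J_N)`: rational vectors that pair
# non-trivially cannot both be short — `1 ≤ h(ξ g) · h(η g)` whenever `⟨ξ, η⟩ ≠ 0`

Topic `NumberTheory/Automorphic`; namespace `Literature.NumberTheory.Automorphic.UnitaryGroup`.
Proof file: theorems only (no definition, no named fact, no instance, no `sorry`); imports = tree.
Setting: the quasi-split unitary group `U(J_N)` of the quadratic extension `E/F` with involution `c`
(`quasiSplit F E c N`, `J_N = antidiag(1, …, 1)`), an adelic point `g ∈ U(J_N)(𝔸_F)` viewed as the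
matrix `adelicVal g ∈ GL_N(𝔸_E)`, rational ROW vectors `ξ, η ∈ E^N` (`principalVec`), their images
`ξ g, η g ∈ 𝔸_E^N` (`ᵥ*`) and the global height `h = vecHeight E` of `AdelicVectorHeight` (sup norms
at the finite places, Euclidean norms at the infinite ones, product formula built in:
`h(κ x) = h(x)` for `κ ∈ Eˣ`). The hermitian form is `⟨x, y⟩ = Σ_i x_i · c(y_{N+1-i}) = x · J_N · ᵗ(c y)`.

* §1 `dotProduct_antidiag_conj_vecMul_eq` — **`U(J_N)(𝔸_F)` preserves the form on row vectors**:
  `⟨x g, y g⟩ = ⟨x, y⟩` for all adelic `x, y` (from `g⁻¹ = J ᵗ(c g) J`, ★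
  `coe_inv_apply_of_mem_unitaryGroupOfForm_antidiagonal`: the vector `k ↦ c((y g)_{rev k})` is
  `g⁻¹` applied to `k ↦ c(y_{rev k})`); `dotProduct_antidiag_conj_principalVec` — on rational vectors
  the form is the principal adele of `Σ_i ξ_i c(η_{rev i}) ∈ E`.
* §2 **`one_le_vecHeight_vecMul_mul_vecHeight_vecMul`** — GODEMENT'S INEQUALITY FOR `U(J_N)`: if
  `Σ_i ξ_i c(η_{rev i}) ≠ 0` then `1 ≤ h(ξ g) · h(η g)` for every `g ∈ U(J_N)(𝔸_F)` (★
  `ideleNorm_le_vecHeight_mul_vecHeight` — `|x · y|_𝔸 ≤ h(x) h(y)` — applied to `x = ξ g` and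
  `y = c((η g) ∘ rev)`, whose height is `h(η g)` by Galois invariance ★ `vecHeight_galSmul` and
  reindexing ★ `vecHeight_comp_equiv`, and whose pairing with `x` is the principal idele
  `Σ_i ξ_i c(η_{rev i})` of norm `1`, ★ `ideleNorm_principal`). Contrapositive
  `pairing_eq_zero_of_vecHeight_mul_lt_one`: **two rational vectors whose images under `g` have
  `h(ξ g) · h(η g) < 1` are orthogonal**; in particular (`isotropic_of_vecHeight_vecMul_sq_lt_one`)
  **a rational vector with `h(ξ g) < 1` is ISOTROPIC** — the first step of reduction theory for
  `U(J_N)` (a short Minkowski vector of the hermitian adelic lattice `g` is automatically isotropic;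
  the special case `ξ = e_N γ`, `η = e_N`, i.e. `H(γ g) H(g) ≤ 1` off the Borel, is ★
  `one_le_vecHeight_lastRow_mul`).
* §3 local forms `nnnorm_pairing_snd_le`, `nnnorm_pairing_fst_le` — at every place,
  `|Σ_i ξ_i c(η_{rev i})|_w ≤ ‖(ξ g)_w‖ · ‖(c((η g) ∘ rev))_w‖` (★ `nnnorm_dotProduct_snd_le`,
  `nnnorm_dotProduct_fst_le`): the Gram matrix of rational vectors whose images under `g` are
  everywhere locally bounded is everywhere locally bounded, hence FINITE in number (Northcott) — the
  second step of the reduction theory.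

Godement, Sém. Bourbaki 257 (1962/63), §1.1 (the inequality `|⟨x, y⟩| ≤ ‖x‖ ‖y‖` and its use:
«si `‖g(e₁)‖` est assez petit, `e₁` est isotrope»), Platonov–Rapinchuk (1994), §5.3 (proof of the
Mahler–Godement compactness criterion); for `U(3)` the reduction theory is quoted in Rogawski
(1990), §2.1–2.2.

## References

* R. Godement, *Domaines fondamentaux des groupes arithmétiques*, Sém. Bourbaki 257 (1962/63),
  §1.1 [Godement1964].
* V. Platonov, A. Rapinchuk, *Algebraic Groups and Number Theory* (1994), §5.3
  [PlatonovRapinchuk1994].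
* J. D. Rogawski, *Automorphic Representations of Unitary Groups in Three Variables* (1990), §2.1
  [Rogawski1990].
-/

set_option autoImplicit false

noncomputable section

open NumberField IsDedekindDomain Matrix
open scoped NNReal MatrixGroups

namespace Literature.NumberTheory.Automorphic

namespace UnitaryGroup

variable {F E : Type} [Field F] [NumberField F] [Field E] [NumberField E] [Algebra F E]
  {c : E ≃ₐ[F] E} {N : ℕ}

/-! ## §1 The hermitian form on row vectors is preserved -/

/-- **The conjugate-reversed image vector is `g⁻¹` applied to the conjugate-reversed vector**:
`c((y g)_{rev k}) = Σ_j (g⁻¹)_{k j} c(y_{rev j})` for `g ∈ U(J_N)(𝔸_F)` (the inverse formula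
`(g⁻¹)_{k j} = c(g_{rev j, rev k})`). [cite: Rogawski1990, §1.9 p. 13] -/
theorem conj_vecMul_rev_eq_inv_mulVec (g : (quasiSplit F E c N).Adelic) (y : Fin N → AdeleRing (𝓞 E) E) :
    (fun k => c • (y ᵥ* (adelicVal F E c N _ g : Matrix (Fin N) (Fin N) (AdeleRing (𝓞 E) E))) (Fin.rev k)) =
      (((adelicVal F E c N _ g)⁻¹ : GL (Fin N) (AdeleRing (𝓞 E) E)) :
        Matrix (Fin N) (Fin N) (AdeleRing (𝓞 E) E)) *ᵥ fun j => c • y (Fin.rev j) := by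
  funext k
  rw [Matrix.mulVec, dotProduct, Matrix.vecMul, dotProduct, ← conjAdele_apply, map_sum]
  rw [← Equiv.sum_comp Fin.revPerm]
  refine Finset.sum_congr rfl fun j _ => ?_
  rw [Fin.revPerm_apply, map_mul, coe_inv_apply_of_mem_unitaryGroupOfForm_antidiagonal
    (conjAdele F E c) N (adelicVal_mem_unitaryGroupOfForm g)]
  simp only [conjAdele_apply]
  exact mul_comm _ _

/-- **`U(J_N)(𝔸_F)` preserves the hermitian form on row vectors**:
`Σ_k (x g)_k · c((y g)_{rev k}) = Σ_k x_k · c(y_{rev k})`. [cite: Rogawski1990, §1.9 p. 13] -/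
theorem dotProduct_antidiag_conj_vecMul_eq (g : (quasiSplit F E c N).Adelic)
    (x y : Fin N → AdeleRing (𝓞 E) E) :
    (x ᵥ* (adelicVal F E c N _ g : Matrix (Fin N) (Fin N) (AdeleRing (𝓞 E) E))) ⬝ᵥ
        (fun k => c • (y ᵥ* (adelicVal F E c N _ g : Matrix (Fin N) (Fin N) (AdeleRing (𝓞 E) E)))
          (Fin.rev k)) =
      x ⬝ᵥ fun k => c • y (Fin.rev k) := by
  rw [conj_vecMul_rev_eq_inv_mulVec, Matrix.dotProduct_mulVec, Matrix.vecMul_vecMul,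
    ← Units.val_mul, mul_inv_cancel, Units.val_one, Matrix.vecMul_one]

omit [NumberField F] in
/-- On rational vectors the form is the principal adele of `Σ_i ξ_i c(η_{rev i})`.
[cite: Rogawski1990, §1.9 p. 13] -/
theorem dotProduct_antidiag_conj_principalVec (ξ η : Fin N → E) :
    (principalVec E ξ ⬝ᵥ fun k => c • principalVec E η (Fin.rev k)) =
      algebraMap E (AdeleRing (𝓞 E) E) (∑ i, ξ i * c (η (Fin.rev i))) := by
  rw [dotProduct, map_sum]
  refine Finset.sum_congr rfl fun i _ => ?_
  rw [map_mul, principalVec_apply, principalVec_apply, ← conjAdele_apply, ← algebraMap_conj]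
  rfl

/-- **The pairing of the images of two rational vectors is a principal adele**:
`Σ_k (ξ g)_k c((η g)_{rev k}) = (Σ_i ξ_i c(η_{rev i}))_𝔸`. [cite: Godement1964, §1.1] -/
theorem dotProduct_antidiag_conj_principalVec_vecMul (g : (quasiSplit F E c N).Adelic) (ξ η : Fin N → E) :
    (principalVec E ξ ᵥ* (adelicVal F E c N _ g : Matrix (Fin N) (Fin N) (AdeleRing (𝓞 E) E))) ⬝ᵥ
        (fun k => c • (principalVec E η ᵥ*
          (adelicVal F E c N _ g : Matrix (Fin N) (Fin N) (AdeleRing (𝓞 E) E))) (Fin.rev k)) =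
      algebraMap E (AdeleRing (𝓞 E) E) (∑ i, ξ i * c (η (Fin.rev i))) := by
  rw [dotProduct_antidiag_conj_vecMul_eq, dotProduct_antidiag_conj_principalVec]

/-! ## §2 Godement's inequality: `1 ≤ h(ξ g) · h(η g)` when `⟨ξ, η⟩ ≠ 0` -/

omit [NumberField F] in
/-- The conjugate-reversed vector `k ↦ c(x_{rev k})` has the same height as `x` (Galois invariance
and reindexing of the height). [cite: Godement1964, §1.1] -/
theorem vecHeight_conj_rev (x : Fin N → AdeleRing (𝓞 E) E) :
    vecHeight E (fun k => c • x (Fin.rev k)) = vecHeight E x := by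
  have h : (fun k => c • x (Fin.rev k)) = c • (x ∘ Fin.revPerm) := rfl
  rw [h, vecHeight_galSmul, vecHeight_comp_equiv]

omit [NumberField F] in
/-- The conjugate-reversed vector has finite height data iff `x` has. [cite: Godement1964, §1.1] -/
theorem isHeightFinite_conj_rev_iff (x : Fin N → AdeleRing (𝓞 E) E) :
    IsHeightFinite E (fun k => c • x (Fin.rev k)) ↔ IsHeightFinite E x := by
  have h : (fun k => c • x (Fin.rev k)) = c • (x ∘ Fin.revPerm) := rfl
  rw [h, isHeightFinite_galSmul_iff, isHeightFinite_comp_equiv_iff]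

/-- **GODEMENT'S INEQUALITY FOR `U(J_N)`.** For `g ∈ U(J_N)(𝔸_F)` and rational row vectors
`ξ, η ∈ E^N` with `⟨ξ, η⟩ = Σ_i ξ_i c(η_{N+1-i}) ≠ 0`:  `1 ≤ h(ξ g) · h(η g)`.
(Godement (1962/63), §1.1: `|⟨x, y⟩|_𝔸 ≤ h(x) h(y)` and `|⟨ξ g, η g⟩|_𝔸 = |⟨ξ, η⟩|_𝔸 = 1` by the
product formula.) [cite: Godement1964, §1.1] -/
theorem one_le_vecHeight_vecMul_mul_vecHeight_vecMul (g : (quasiSplit F E c N).Adelic) {ξ η : Fin N → E}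
    (hne : ∑ i, ξ i * c (η (Fin.rev i)) ≠ 0) :
    1 ≤ vecHeight E (principalVec E ξ ᵥ* (adelicVal F E c N _ g : Matrix (Fin N) (Fin N) (AdeleRing (𝓞 E) E))) *
      vecHeight E (principalVec E η ᵥ* (adelicVal F E c N _ g : Matrix (Fin N) (Fin N) (AdeleRing (𝓞 E) E))) := by
  classical
  have hξ : ξ ≠ 0 := by
    rintro rfl
    exact hne (by simp)
  have hη : η ≠ 0 := by
    rintro rfl
    exact hne (by simp)
  set a : Eˣ := Units.mk0 _ hne with ha
  have hnorm : IdeleClassGroup.ideleNorm E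
      (Units.map (algebraMap E (AdeleRing (𝓞 E) E) : E →* AdeleRing (𝓞 E) E) a) = 1 :=
    ideleNorm_principal ⟨a, rfl⟩
  rw [← hnorm, ← vecHeight_conj_rev (c := c)
    (principalVec E η ᵥ* (adelicVal F E c N _ g : Matrix (Fin N) (Fin N) (AdeleRing (𝓞 E) E)))]
  exact ideleNorm_le_vecHeight_mul_vecHeight (isHeightFinite_principalVec_vecMul hξ _)
    ((isHeightFinite_conj_rev_iff _).2 (isHeightFinite_principalVec_vecMul hη _)) _
    (by rw [Units.coe_map, dotProduct_antidiag_conj_principalVec_vecMul, Units.val_mk0, MonoidHom.coe_coe])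

/-- **Short images are orthogonal**: if `h(ξ g) · h(η g) < 1` then `⟨ξ, η⟩ = 0`.
[cite: Godement1964, §1.1] -/
theorem pairing_eq_zero_of_vecHeight_mul_lt_one (g : (quasiSplit F E c N).Adelic) {ξ η : Fin N → E}
    (hlt : vecHeight E (principalVec E ξ ᵥ* (adelicVal F E c N _ g : Matrix (Fin N) (Fin N) (AdeleRing (𝓞 E) E))) *
      vecHeight E (principalVec E η ᵥ* (adelicVal F E c N _ g : Matrix (Fin N) (Fin N) (AdeleRing (𝓞 E) E))) < 1) :
    ∑ i, ξ i * c (η (Fin.rev i)) = 0 := by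
  by_contra hne
  exact absurd (one_le_vecHeight_vecMul_mul_vecHeight_vecMul g hne) (not_le.2 hlt)

/-- **A SHORT RATIONAL VECTOR IS ISOTROPIC**: if `h(ξ g) < 1` (more precisely `h(ξ g)² < 1`) for some
`g ∈ U(J_N)(𝔸_F)`, then `⟨ξ, ξ⟩ = Σ_i ξ_i c(ξ_{N+1-i}) = 0` (Godement: «si `‖g(e₁)‖` est assez petit,
`e₁` est isotrope»). [cite: Godement1964, §1.1] -/
theorem isotropic_of_vecHeight_vecMul_sq_lt_one (g : (quasiSplit F E c N).Adelic) {ξ : Fin N → E}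
    (hlt : vecHeight E (principalVec E ξ ᵥ* (adelicVal F E c N _ g : Matrix (Fin N) (Fin N) (AdeleRing (𝓞 E) E))) ^ 2 < 1) :
    ∑ i, ξ i * c (ξ (Fin.rev i)) = 0 :=
  pairing_eq_zero_of_vecHeight_mul_lt_one g (by rwa [← sq])

/-- The same with the hypothesis `h(ξ g) < 1`. [cite: Godement1964, §1.1] -/
theorem isotropic_of_vecHeight_vecMul_lt_one (g : (quasiSplit F E c N).Adelic) {ξ : Fin N → E}
    (hlt : vecHeight E (principalVec E ξ ᵥ* (adelicVal F E c N _ g : Matrix (Fin N) (Fin N) (AdeleRing (𝓞 E) E))) < 1) :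
    ∑ i, ξ i * c (ξ (Fin.rev i)) = 0 :=
  isotropic_of_vecHeight_vecMul_sq_lt_one g (by
    calc vecHeight E (principalVec E ξ ᵥ* (adelicVal F E c N _ g : Matrix (Fin N) (Fin N) (AdeleRing (𝓞 E) E))) ^ 2
        ≤ vecHeight E (principalVec E ξ ᵥ* (adelicVal F E c N _ g : Matrix (Fin N) (Fin N) (AdeleRing (𝓞 E) E))) := by
          rw [sq]; exact mul_le_of_le_one_left (by positivity) hlt.le
      _ < 1 := hlt)

/-! ## §3 Local forms: the Gram matrix of everywhere-bounded vectors is everywhere bounded -/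

/-- **Finite places**: `|Σ_i ξ_i c(η_{rev i})|_v ≤ ‖(ξ g)_v‖ · ‖(c((η g) ∘ rev))_v‖` (ultrametric,
★ `nnnorm_dotProduct_snd_le`). [cite: Godement1964, §1.1] -/
theorem nnnorm_pairing_snd_le (g : (quasiSplit F E c N).Adelic) (ξ η : Fin N → E)
    (v : HeightOneSpectrum (𝓞 E)) :
    ‖(algebraMap E (AdeleRing (𝓞 E) E) (∑ i, ξ i * c (η (Fin.rev i)))).2 v‖₊ ≤
      vecFinHeight E v (principalVec E ξ ᵥ* (adelicVal F E c N _ g : Matrix (Fin N) (Fin N) (AdeleRing (𝓞 E) E))) *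
        vecFinHeight E v (fun k => c • (principalVec E η ᵥ*
          (adelicVal F E c N _ g : Matrix (Fin N) (Fin N) (AdeleRing (𝓞 E) E))) (Fin.rev k)) := by
  rw [← dotProduct_antidiag_conj_principalVec_vecMul g ξ η]
  exact nnnorm_dotProduct_snd_le v _ _

/-- **Infinite places**: `|Σ_i ξ_i c(η_{rev i})|_w ≤ ‖(ξ g)_w‖ · ‖(c((η g) ∘ rev))_w‖` (Cauchy–Schwarz,
★ `nnnorm_dotProduct_fst_le`). [cite: Godement1964, §1.1] -/
theorem nnnorm_pairing_fst_le (g : (quasiSplit F E c N).Adelic) (ξ η : Fin N → E) (w : InfinitePlace E) :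
    ‖(algebraMap E (AdeleRing (𝓞 E) E) (∑ i, ξ i * c (η (Fin.rev i)))).1 w‖₊ ≤
      vecArchNorm E w (principalVec E ξ ᵥ* (adelicVal F E c N _ g : Matrix (Fin N) (Fin N) (AdeleRing (𝓞 E) E))) *
        vecArchNorm E w (fun k => c • (principalVec E η ᵥ*
          (adelicVal F E c N _ g : Matrix (Fin N) (Fin N) (AdeleRing (𝓞 E) E))) (Fin.rev k)) := by
  rw [← dotProduct_antidiag_conj_principalVec_vecMul g ξ η]
  exact nnnorm_dotProduct_fst_le w _ _

omit [NumberField F] in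
/-- The local heights of the conjugate-reversed vector are those of the vector at the conjugate place
(finite places). [cite: Godement1964, §1.1] -/
theorem vecFinHeight_conj_rev (v : HeightOneSpectrum (𝓞 E)) (x : Fin N → AdeleRing (𝓞 E) E) :
    vecFinHeight E v (fun k => c • x (Fin.rev k)) = vecFinHeight E (c⁻¹ • v) x := by
  have h : (fun k => c • x (Fin.rev k)) = c • (x ∘ Fin.revPerm) := rfl
  rw [h, vecFinHeight_galSmul, vecFinHeight_comp_equiv]

omit [NumberField F] in
/-- The same at the infinite places. [cite: Godement1964, §1.1] -/
theorem vecArchNorm_conj_rev (w : InfinitePlace E) (x : Fin N → AdeleRing (𝓞 E) E) :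
    vecArchNorm E w (fun k => c • x (Fin.rev k)) = vecArchNorm E (c⁻¹ • w) x := by
  have h : (fun k => c • x (Fin.rev k)) = c • (x ∘ Fin.revPerm) := rfl
  rw [h, vecArchNorm_galSmul, vecArchNorm_comp_equiv]

end UnitaryGroup

end Literature.NumberTheory.Automorphic
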